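/-
Copyright: the b2b-balaban T⁴-continuum CRUX team, row NE7b leaf lineage `t4-ne7b-formalise-leaf-02` (gen 134). Project licence.
-/
import Summits.QuantumFields.BalabanUV.T4Continuum.Spine.NE7b.TentPartitionProduct
import Summits.QuantumFields.BalabanUV.T4Continuum.Spine.NE7b.TentUnityTorusSupport
import Summits.QuantumFields.BalabanUV.T4Continuum.Spine.NE7b.PartitionPathLetters
import Mathlib.Algebra.BigOperators.Group.Finset.Piecewise

/-!
# THE CITED TENT PARTITION ON THE DISCRETE TORUS `(ℤ∕Nℤ)^d`, `N = M·L`: `Φ_S(ξ) = Π_ν h(ξ_ν − (S_ν L + c))` ([Balaban1988Convergent] (3.40) p. 275) HAS THE FOUR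
# LETTERS OF `…AdmissibleFloorLinearPartition` — `Σ_S Φ_S = 1`, at most `2^d` cubes alive at a site, every unit move `ξ ↦ ξ ± e_ν` moves the column by at
# most `√2∕L` in `ℓ²(cubes)`, hence chains of `≤ D` unit moves give the TERM letter `Λ = D√2∕L`, and the term multiplicity is `(a+1)·2^d`
# (row NE7b, node U5c; residual (R2′) family (2), letter (ℓ1); the junction of the tent supplier — lattice geometry of the (h2) slot at k = 1)

Cell `pub-balaban`, sub-cell `t4`, spine estimate NE7b (`T4WeightBudget.RelWeightBound`; the cell's OWN estimate — NOT PRINTED in [Bałaban 1983–89],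
NOT PROVED).  Crux-route work under `Spine/NE7b/`; NOTHING of Bałaban's estimates is asserted; no `def`; zero `sorry`; no `T4Continuum/Support` leaf
(FREEZE (0)).  Imports, all BY NAME: `…TentPartitionProduct` (TPP, leaf-05 g157: `sum_prod_eq_one`, `card_alive_prod_le_pow`, `sum_sq_prod_update_sub_le` —
the `d`-axis product, abstract in the one-axis family), `…TentUnityTorusSupport` (TUS, this lineage: `tentZ_le_one`, `card_alive_tentZ_le_two`,
`sum_sq_tentZ_step_le` over the cited `B14TentUnityTorus.tentZ` ∕ `sum_tentZ_sub_eq_one` and leaf-05's `…TentUnityTorusSteps`), `…PartitionPathLetters`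
(PPaL, this lineage: `hvar_of_chains`, `card_alive_on_term_le_of_le`).

WHY.  The (h2) slot's floor `…AdmissibleFloorLinearPartition.ims_floor_of_linear_partition` (AFLP) displays a LINEAR partition `φ : ι → C → ℝ` on the bond
index set `C` through four letters `hsum`, `hmult` (`μ₀`), `hvar` (`Λ` on each term), `hμ` (`μ` on each term).  Print's partition is the tent (3.40) on
cubes of side `L` (the PARTITION scale — print's `M`-cubes of [B6] Sect. A; here in the letters of `sum_tentZ_sub_eq_one`: `L` = cube side, `M` = cubes per
axis, `N = M·L` = sites per axis of the unit torus), read on a bond through a site `pt c` (its start point).  THIS FILE assembles the suppliers into those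
four letters ON THE TORUS `A → ZMod N` (`A = Fin d`), leaving to the consumer only the bond-to-site map `pt` and, per term, a displacement witness of
`ℓ¹`-length `≤ D` from the reference bond's site to each bond's site (plaquettes: `D = 1`; the bonds of one `L′`-block average: `D ≤ d(L′−1)`-type).

WHAT IS PROVED ([folklore]; `0 < L`, `2 ≤ M`, `N = M·L`, offset `c : ℕ`; `Φ_S(ξ) := Π_ν tentZ L (ξ ν − ((S ν).val·L + c))` written out, `S : A → ZMod M`):
* §1 **`sum_prod_tentZ_eq_one`** (`Σ_S Φ_S(ξ) = 1` — AFLP's `hsum`), `prod_tentZ_nonneg`, `prod_tentZ_le_one`.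
* §2 **`card_alive_prod_tentZ_le`** (`#{S : Φ_S(ξ) ≠ 0} ≤ 2^{#A}` — AFLP's `hmult`, `μ₀ = 2^d`); §2b `filter_alive_prod_tentZ_subset_box`,
  **`filter_alive_prod_tentZ_add_one_subset_box`** (the alive cubes at `ξ` AND at `update ξ ν (ξ ν + 1)` lie in the ONE box `Π_κ{q̄(ξ_κ), q̄(ξ_κ)+1}`), `card_box_le`.
* §3 unit moves: **`sum_sq_prod_tentZ_add_one_le`** ∕ **`sum_sq_prod_tentZ_sub_one_le`** (`Σ_S (Φ_S(update ξ ν (ξ ν ± 1)) − Φ_S(ξ))² ≤ 2∕L²`).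
* §4 chains (generic in a column family `Ψ` with a unit-move letter `β`): `exists_chain_nsmul` (`n = Σ_ν w_ν` moves `+u` reach `ξ + w·u`), **`exists_chain`**
  (`Σw⁺ + Σw⁻` moves reach `ξ + w⁺ − w⁻`, every step within `β`).
* §5 **`hvar_tentZ_torus`** — AFLP's `hvar` VERBATIM for `φ_S(c) := Φ_S(pt c)`: if every bond `c ∈ inc j` has `pt c = pt (ref j) + w⁺ − w⁻` with
  `Σw⁺ + Σw⁻ ≤ D`, then `Σ_S (φ_S(c) − φ_S(ref j))² ≤ (D·(√2∕L))²` (PPaL `hvar_of_chains` ∘ §4 ∘ §3).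
* §6 **`card_alive_on_term_tentZ_le`** — AFLP's `hμ` VERBATIM: `#{S : ∃ c ∈ inc j, φ_S(c) ≠ 0 ∨ φ_S(ref j) ≠ 0} ≤ (a + 1)·2^{#A}` (PPaL ∘ §2);
  **`card_alive_on_term_tentZ_le_of_unit`** — SHARPER `μ = 2^{#A}` when every bond of the term sits at the reference site or one FORWARD unit move from
  it (plaquettes; §2b), and `hdisp_of_unit` (that letter implies §5's `hdisp` with `D = 1`).
* §7 toy: one axis (`A = Unit`), `M = 2`, `L = 1`: `Σ_S Φ_S = 1` (`example` via §1).

NOT HERE (honest): the bond-to-site map and the displacement witnesses of plaquette ∕ block-average terms (`TorusPlaquetteIncidence`-level bookkeeping of the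
consumer), the normalisation `h = φ∕‖φ‖₂` (QPU) and the floor itself (AFLP — one `exact` away once AFST ∕ QPU ∕ AFLP are in the tree), the identification of
the unit torus of `…OneStepAveragePeriodicity` (`tcls (LM) : ℤ^d → (ℤ∕LM)^d`) with `A → ZMod N` here (same type at `N = LM`; the partition scale must divide
the period); anything of Bałaban's estimates.  BY-NAME EFFECT ON THE WALL: NONE.  NE7b NOT PRINTED ∕ NOT PROVED; spine PROVED 0∕9; rung (B)+1 on ONE finite
T⁴ — NOT infinite volume, NOT the mass gap, NOT Clay.
HONEST DEPENDENCY: continuum YM on T⁴ ⇐ BetaPertH ∧ nine spine estimates (0/9 proved); BetaPertH ⇐ (D1) ∧ (D4) ∧ CAP+tail; G-an2-4 gates asym, D1 and NE2/3/4.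
-/

set_option autoImplicit false

noncomputable section

open Finset
open Literature.MathematicalPhysics.QuantumFieldTheory.Balaban1983to89.B14.TentUnityTorus (tentZ tentZ_nonneg sum_tentZ_sub_eq_one)
open Summit.QuantumFields.BalabanUV.T4Continuum.NE7b.TentPartitionProduct (sum_prod_eq_one prod_nonneg' prod_le_one' card_alive_prod_le_pow
  sum_sq_prod_update_sub_le)
open Summit.QuantumFields.BalabanUV.T4Continuum.NE7b.TentUnityTorusSupport (tentZ_le_one card_alive_tentZ_le_two sum_sq_tentZ_step_le
  filter_tentZ_ne_zero_subset_pair filter_tentZ_ne_zero_add_one_subset_pair)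
open Summit.QuantumFields.BalabanUV.T4Continuum.NE7b.PartitionPathLetters (hvar_of_chains card_alive_on_term_le_of_le)

namespace Summit.QuantumFields.BalabanUV.T4Continuum.NE7b.TentPartitionTorus

variable {A : Type*} [Fintype A] [DecidableEq A]

/-! ## §1 Partition of unity on the torus -/

/-- **`Σ_S Π_ν h(ξ_ν − (S_ν L + c)) = 1`** on `A → ZMod N`, `N = M·L`, `2 ≤ M` — TPP `sum_prod_eq_one` fed by the cited circle identity `sum_tentZ_sub_eq_one`;
AFLP's `hsum`. [folklore] -/
theorem sum_prod_tentZ_eq_one (L M N : ℕ) [NeZero M] [NeZero N] (hL : 0 < L) (hM : 2 ≤ M) (hN : N = M * L) (c : ℕ) (ξ : A → ZMod N) :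
    ∑ S : A → ZMod M, ∏ ν, tentZ (L : ℝ) (ξ ν - (((S ν).val * L + c : ℕ) : ZMod N)) = 1 :=
  sum_prod_eq_one (fun (b : ZMod M) (a : ZMod N) => tentZ (L : ℝ) (a - ((b.val * L + c : ℕ) : ZMod N)))
    (fun a => sum_tentZ_sub_eq_one L M hL hM N hN c a) ξ

omit [Fintype A] [DecidableEq A] in
/-- `0 ≤ Φ_S(ξ)`. [folklore] -/
theorem prod_tentZ_nonneg (L N : ℕ) {M : ℕ} (c : ℕ) (S : A → ZMod M) (ξ : A → ZMod N) (T : Finset A) :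
    0 ≤ ∏ ν ∈ T, tentZ (L : ℝ) (ξ ν - (((S ν).val * L + c : ℕ) : ZMod N)) :=
  Finset.prod_nonneg fun _ _ => tentZ_nonneg _ _

omit [Fintype A] [DecidableEq A] in
/-- `Φ_S(ξ) ≤ 1` (`0 < L`). [folklore] -/
theorem prod_tentZ_le_one (L N : ℕ) {M : ℕ} (hL : 0 < L) (c : ℕ) (S : A → ZMod M) (ξ : A → ZMod N) (T : Finset A) :
    ∏ ν ∈ T, tentZ (L : ℝ) (ξ ν - (((S ν).val * L + c : ℕ) : ZMod N)) ≤ 1 :=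
  Finset.prod_le_one (fun _ _ => tentZ_nonneg _ _) fun _ _ => tentZ_le_one (by exact_mod_cast hL) _

/-! ## §2 At most `2^d` cubes alive at a site -/

/-- **`#{S : Φ_S(ξ) ≠ 0} ≤ 2^{#A}`** — TPP `card_alive_prod_le_pow` fed by TUS `card_alive_tentZ_le_two`; AFLP's `hmult` with `μ₀ = 2^d`. [folklore] -/
theorem card_alive_prod_tentZ_le (L M N : ℕ) [NeZero M] [NeZero N] (hL : 0 < L) (hN : N = M * L) (c : ℕ) (ξ : A → ZMod N) :
    (Finset.univ.filter fun S : A → ZMod M => ∏ ν, tentZ (L : ℝ) (ξ ν - (((S ν).val * L + c : ℕ) : ZMod N)) ≠ 0).card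
      ≤ 2 ^ Fintype.card A :=
  card_alive_prod_le_pow (fun (b : ZMod M) (a : ZMod N) => tentZ (L : ℝ) (a - ((b.val * L + c : ℕ) : ZMod N)))
    (fun a => card_alive_tentZ_le_two L M N hL hN c a) ξ


/-! ## §2b The alive cubes at `ξ` and at `ξ + e_ν` sit in ONE box of `2^{#A}` cubes -/

/-- The alive cubes at `ξ` lie in the box `Π_κ {q̄(ξ_κ), q̄(ξ_κ) + 1}` (`q̄(a) = ↑((a − c).val ∕ L)`; a product is nonzero only if every factor is,
TUS `filter_tentZ_ne_zero_subset_pair` per axis). [folklore] -/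
theorem filter_alive_prod_tentZ_subset_box (L M N : ℕ) [NeZero M] [NeZero N] (hL : 0 < L) (hN : N = M * L) (c : ℕ) (ξ : A → ZMod N) :
    (Finset.univ.filter fun S : A → ZMod M => ∏ ν, tentZ (L : ℝ) (ξ ν - (((S ν).val * L + c : ℕ) : ZMod N)) ≠ 0)
      ⊆ Fintype.piFinset fun κ =>
        ({((((ξ κ - (c : ZMod N)).val / L : ℕ)) : ZMod M), ((((ξ κ - (c : ZMod N)).val / L : ℕ)) : ZMod M) + 1} : Finset (ZMod M)) := by
  intro S hS
  rw [Finset.mem_filter] at hS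
  rw [Fintype.mem_piFinset]
  intro κ
  have hκ : tentZ (L : ℝ) (ξ κ - (((S κ).val * L + c : ℕ) : ZMod N)) ≠ 0 := fun h0 =>
    hS.2 (Finset.prod_eq_zero (Finset.mem_univ κ) h0)
  exact filter_tentZ_ne_zero_subset_pair L M N hL hN c (ξ κ) (Finset.mem_filter.mpr ⟨Finset.mem_univ _, hκ⟩)

/-- **THE ALIVE CUBES ONE FORWARD MOVE AWAY LIE IN THE SAME BOX**: at `update ξ ν (ξ ν + 1)` the alive cubes are still in `Π_κ {q̄(ξ_κ), q̄(ξ_κ) + 1}` — the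
box OF `ξ` (TUS `filter_tentZ_ne_zero_add_one_subset_pair` on the axis `ν`, `…_subset_pair` elsewhere; `2 ≤ M`). [folklore] -/
theorem filter_alive_prod_tentZ_add_one_subset_box (L M N : ℕ) [NeZero M] [NeZero N] (hL : 0 < L) (hM : 2 ≤ M) (hN : N = M * L) (c : ℕ)
    (ξ : A → ZMod N) (ν : A) :
    (Finset.univ.filter fun S : A → ZMod M =>
        ∏ κ, tentZ (L : ℝ) (Function.update ξ ν (ξ ν + 1) κ - (((S κ).val * L + c : ℕ) : ZMod N)) ≠ 0)
      ⊆ Fintype.piFinset fun κ =>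
        ({((((ξ κ - (c : ZMod N)).val / L : ℕ)) : ZMod M), ((((ξ κ - (c : ZMod N)).val / L : ℕ)) : ZMod M) + 1} : Finset (ZMod M)) := by
  intro S hS
  rw [Finset.mem_filter] at hS
  rw [Fintype.mem_piFinset]
  intro κ
  have hκ : tentZ (L : ℝ) (Function.update ξ ν (ξ ν + 1) κ - (((S κ).val * L + c : ℕ) : ZMod N)) ≠ 0 := fun h0 =>
    hS.2 (Finset.prod_eq_zero (Finset.mem_univ κ) h0)
  by_cases h : κ = ν
  · subst h
    rw [Function.update_self] at hκ
    exact filter_tentZ_ne_zero_add_one_subset_pair L M N hL hM hN c (ξ κ) (Finset.mem_filter.mpr ⟨Finset.mem_univ _, hκ⟩)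
  · rw [Function.update_of_ne h] at hκ
    exact filter_tentZ_ne_zero_subset_pair L M N hL hN c (ξ κ) (Finset.mem_filter.mpr ⟨Finset.mem_univ _, hκ⟩)

/-- The box has at most `2^{#A}` cubes. [folklore] -/
theorem card_box_le (M N L : ℕ) (c : ℕ) (ξ : A → ZMod N) :
    (Fintype.piFinset fun κ =>
        ({((((ξ κ - (c : ZMod N)).val / L : ℕ)) : ZMod M), ((((ξ κ - (c : ZMod N)).val / L : ℕ)) : ZMod M) + 1} : Finset (ZMod M))).card
      ≤ 2 ^ Fintype.card A := by
  rw [Fintype.card_piFinset, ← Finset.card_univ, ← Finset.prod_const]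
  exact Finset.prod_le_prod' fun κ _ => (Finset.card_insert_le _ _).trans (by simp)

/-! ## §3 Unit moves move the column by at most `√2∕L` in `ℓ²(cubes)` -/

/-- **FORWARD UNIT MOVE**: `Σ_S (Φ_S(update ξ ν (ξ ν + 1)) − Φ_S(ξ))² ≤ 2∕L²` — TPP `sum_sq_prod_update_sub_le` (constant one across the axes) then TUS
`sum_sq_tentZ_step_le` on the axis `ν`. [folklore] -/
theorem sum_sq_prod_tentZ_add_one_le (L M N : ℕ) [NeZero M] [NeZero N] (hL : 0 < L) (hM : 2 ≤ M) (hN : N = M * L) (c : ℕ)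
    (ξ : A → ZMod N) (ν : A) :
    ∑ S : A → ZMod M, (∏ μ, tentZ (L : ℝ) (Function.update ξ ν (ξ ν + 1) μ - (((S μ).val * L + c : ℕ) : ZMod N))
        - ∏ μ, tentZ (L : ℝ) (ξ μ - (((S μ).val * L + c : ℕ) : ZMod N))) ^ 2 ≤ 2 / (L : ℝ) ^ 2 :=
  (sum_sq_prod_update_sub_le (fun (b : ZMod M) (a : ZMod N) => tentZ (L : ℝ) (a - ((b.val * L + c : ℕ) : ZMod N)))
      (fun _ _ => tentZ_nonneg _ _) (fun _ _ => tentZ_le_one (by exact_mod_cast hL) _)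
      (fun a => sum_tentZ_sub_eq_one L M hL hM N hN c a) ξ ν (ξ ν + 1)).trans
    (sum_sq_tentZ_step_le L M N hL hM hN c (ξ ν))

/-- **BACKWARD UNIT MOVE**: `Σ_S (Φ_S(update ξ ν (ξ ν − 1)) − Φ_S(ξ))² ≤ 2∕L²` (the forward move from `update ξ ν (ξ ν − 1)` lands on `ξ`; squares are
symmetric). [folklore] -/
theorem sum_sq_prod_tentZ_sub_one_le (L M N : ℕ) [NeZero M] [NeZero N] (hL : 0 < L) (hM : 2 ≤ M) (hN : N = M * L) (c : ℕ)
    (ξ : A → ZMod N) (ν : A) :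
    ∑ S : A → ZMod M, (∏ μ, tentZ (L : ℝ) (Function.update ξ ν (ξ ν - 1) μ - (((S μ).val * L + c : ℕ) : ZMod N))
        - ∏ μ, tentZ (L : ℝ) (ξ μ - (((S μ).val * L + c : ℕ) : ZMod N))) ^ 2 ≤ 2 / (L : ℝ) ^ 2 := by
  set ξ' : A → ZMod N := Function.update ξ ν (ξ ν - 1) with hξ'
  have hback : Function.update ξ' ν (ξ' ν + 1) = ξ := by
    rw [hξ', Function.update_self, sub_add_cancel, Function.update_idem, Function.update_eq_self]
  have h := sum_sq_prod_tentZ_add_one_le L M N hL hM hN c ξ' ν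
  rw [hback] at h
  refine le_of_eq_of_le (Finset.sum_congr rfl fun S _ => ?_) h
  ring

/-! ## §4 Chains of unit moves (generic in the column family) -/

/-- `Σ_ν w_ν` moves `+u` in the coordinates prescribed by `w : A → ℕ` lead from `ξ` to `ξ + w·u`, each step obeying the unit-move letter `β` of the column
family `Ψ` (induction on `Σ_ν w_ν`: move once in a coordinate with `w_ν ≠ 0`, then recurse). [folklore] -/
theorem exists_chain_nsmul {K : Type*} [Fintype K] {N : ℕ} (Ψ : K → (A → ZMod N) → ℝ) (u : ZMod N) {β : ℝ}
    (hstep : ∀ (ζ : A → ZMod N) (ν : A), ∑ S, (Ψ S (Function.update ζ ν (ζ ν + u)) - Ψ S ζ) ^ 2 ≤ β)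
    (n : ℕ) : ∀ (w : A → ℕ) (ξ : A → ZMod N), ∑ ν, w ν = n →
      ∃ p : ℕ → (A → ZMod N), p 0 = ξ ∧ p n = ξ + (fun ν => ((w ν : ℕ) : ZMod N) * u) ∧
        ∀ i < n, ∑ S, (Ψ S (p (i + 1)) - Ψ S (p i)) ^ 2 ≤ β := by
  induction n with
  | zero =>
    intro w ξ hw
    have hw0 : ∀ ν, w ν = 0 := fun ν => (Finset.sum_eq_zero_iff.mp hw) ν (Finset.mem_univ ν)
    refine ⟨fun _ => ξ, rfl, ?_, fun i hi => absurd hi (Nat.not_lt_zero i)⟩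
    funext ν
    simp [hw0 ν]
  | succ n ih =>
    intro w ξ hw
    obtain ⟨ν₀, -, hν₀⟩ : ∃ ν₀ ∈ (Finset.univ : Finset A), w ν₀ ≠ 0 :=
      Finset.exists_ne_zero_of_sum_ne_zero (by rw [hw]; exact Nat.succ_ne_zero n)
    obtain ⟨k, hk⟩ : ∃ k, w ν₀ = k + 1 := Nat.exists_eq_succ_of_ne_zero hν₀
    -- one move in the coordinate `ν₀`, then the induction hypothesis for the remaining displacement
    set w₁ : A → ℕ := Function.update w ν₀ k with hw₁
    set ξ₁ : A → ZMod N := Function.update ξ ν₀ (ξ ν₀ + u) with hξ₁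
    have hsum₁ : ∑ ν, w₁ ν = n := by
      have h1 : ∑ ν, w₁ ν = k + ∑ ν ∈ Finset.univ \ {ν₀}, w ν := by
        rw [hw₁, Finset.sum_update_of_mem (Finset.mem_univ ν₀)]
      have h2 : ∑ ν, w ν = w ν₀ + ∑ ν ∈ Finset.univ.erase ν₀, w ν := (Finset.add_sum_erase _ _ (Finset.mem_univ ν₀)).symm
      have h3 : Finset.univ \ {ν₀} = Finset.univ.erase ν₀ := by ext; simp
      rw [h3] at h1
      omega
    obtain ⟨q, hq0, hqn, hqstep⟩ := ih w₁ ξ₁ hsum₁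
    refine ⟨fun i => if i = 0 then ξ else q (i - 1), by simp, ?_, ?_⟩
    · -- the end point: `ξ₁ + w₁·u = ξ + w·u`
      simp only [Nat.succ_ne_zero, if_false, Nat.add_sub_cancel]
      rw [hqn]
      funext μ
      by_cases hμ : μ = ν₀
      · subst hμ
        simp only [hξ₁, hw₁, Pi.add_apply, Function.update_self, hk]
        push_cast
        ring
      · simp only [hξ₁, hw₁, Pi.add_apply, Function.update_of_ne hμ]
    · -- the steps: the first one is the unit move at `ξ`, the others are the chain's
      intro i hi
      rcases i with _ | i
      · simp only [Nat.zero_add, one_ne_zero, if_false, if_true, Nat.sub_self, hq0, hξ₁]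
        exact hstep ξ ν₀
      · simp only [Nat.succ_ne_zero, if_false, Nat.succ_sub_one]
        exact hqstep i (by omega)

/-- **CHAINS**: `Σ_νw⁺_ν + Σ_νw⁻_ν` unit moves (first the `+1` moves of `w⁺`, then the `−1` moves of `w⁻`) lead from `ξ` to `ξ + w⁺ − w⁻`, each step obeying the
unit-move letter `β` (forward and backward letters assumed). [folklore] -/
theorem exists_chain {K : Type*} [Fintype K] {N : ℕ} (Ψ : K → (A → ZMod N) → ℝ) {β : ℝ}
    (hfwd : ∀ (ζ : A → ZMod N) (ν : A), ∑ S, (Ψ S (Function.update ζ ν (ζ ν + 1)) - Ψ S ζ) ^ 2 ≤ β)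
    (hbwd : ∀ (ζ : A → ZMod N) (ν : A), ∑ S, (Ψ S (Function.update ζ ν (ζ ν - 1)) - Ψ S ζ) ^ 2 ≤ β)
    (wp wm : A → ℕ) (ξ : A → ZMod N) :
    ∃ p : ℕ → (A → ZMod N), p 0 = ξ ∧
      p (∑ ν, wp ν + ∑ ν, wm ν) = ξ + (fun ν => ((wp ν : ℕ) : ZMod N)) - (fun ν => ((wm ν : ℕ) : ZMod N)) ∧
      ∀ i < ∑ ν, wp ν + ∑ ν, wm ν, ∑ S, (Ψ S (p (i + 1)) - Ψ S (p i)) ^ 2 ≤ β := by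
  set n₁ := ∑ ν, wp ν with hn₁
  set n₂ := ∑ ν, wm ν with hn₂
  obtain ⟨p₁, hp₁0, hp₁n, hp₁s⟩ := exists_chain_nsmul Ψ 1 (by simpa using hfwd) n₁ wp ξ rfl
  have hbwd' : ∀ (ζ : A → ZMod N) (ν : A), ∑ S, (Ψ S (Function.update ζ ν (ζ ν + -1)) - Ψ S ζ) ^ 2 ≤ β := by
    intro ζ ν; rw [← sub_eq_add_neg]; exact hbwd ζ ν
  obtain ⟨p₂, hp₂0, hp₂n, hp₂s⟩ := exists_chain_nsmul Ψ (-1) hbwd' n₂ wm (p₁ n₁) rfl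
  refine ⟨fun i => if i < n₁ then p₁ i else p₂ (i - n₁), ?_, ?_, ?_⟩
  · -- start (if there is no forward move, the backward chain starts at `p₁ n₁ = p₁ 0 = ξ`)
    show (if 0 < n₁ then p₁ 0 else p₂ (0 - n₁)) = ξ
    by_cases h0 : 0 < n₁
    · rw [if_pos h0, hp₁0]
    · rw [if_neg h0, Nat.zero_sub, hp₂0, show n₁ = 0 by omega, hp₁0]
  · -- end
    show (if n₁ + n₂ < n₁ then p₁ (n₁ + n₂) else p₂ (n₁ + n₂ - n₁)) = _
    rw [if_neg (by omega), Nat.add_sub_cancel_left, hp₂n, hp₁n]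
    funext ν
    simp only [Pi.add_apply, Pi.sub_apply, mul_one, mul_neg, ← sub_eq_add_neg]
  · -- steps
    intro i hi
    show ∑ S, (Ψ S (if i + 1 < n₁ then p₁ (i + 1) else p₂ (i + 1 - n₁)) - Ψ S (if i < n₁ then p₁ i else p₂ (i - n₁))) ^ 2 ≤ β
    by_cases h1 : i + 1 < n₁
    · rw [if_pos h1, if_pos (by omega)]
      exact hp₁s i (by omega)
    · by_cases h2 : i < n₁
      · -- the seam: `p (i+1) = p₂ 0 = p₁ n₁ = p₁ (i+1)`
        have hin : i + 1 = n₁ := by omega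
        rw [if_neg h1, if_pos h2, hin, Nat.sub_self, hp₂0, ← hin]
        exact hp₁s i (by omega)
      · rw [if_neg h1, if_neg h2, show i + 1 - n₁ = (i - n₁) + 1 by omega]
        exact hp₂s (i - n₁) (by omega)

/-! ## §5 AFLP's term-variation letter `hvar` on the torus -/

/-- **AFLP's `hvar` ON THE TORUS**: bonds `c : C` read at sites `pt c : A → ZMod N`; if every bond `c ∈ inc j` sits at `pt c = pt (ref j) + w⁺ − w⁻` with
`Σw⁺ + Σw⁻ ≤ D` (an `ℓ¹`-displacement of length `≤ D` on the torus), then `Σ_S (Φ_S(pt c) − Φ_S(pt (ref j)))² ≤ (D·(√2∕L))²` — PPaL `hvar_of_chains` with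
`η = √2∕L` over the chains of §4 and the unit-move letters of §3.  AFLP's `Λ = D√2∕L`; no `2^d`. [folklore] -/
theorem hvar_tentZ_torus (L M N : ℕ) [NeZero M] [NeZero N] (hL : 0 < L) (hM : 2 ≤ M) (hN : N = M * L) (c : ℕ)
    {C J : Type*} (pt : C → A → ZMod N) (inc : J → Finset C) (ref : J → C) (D : ℕ)
    (hdisp : ∀ j, ∀ b ∈ inc j, ∃ wp wm : A → ℕ,
      pt b = pt (ref j) + (fun ν => ((wp ν : ℕ) : ZMod N)) - (fun ν => ((wm ν : ℕ) : ZMod N)) ∧ ∑ ν, wp ν + ∑ ν, wm ν ≤ D) :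
    ∀ j, ∀ b ∈ inc j,
      ∑ S : A → ZMod M, (∏ ν, tentZ (L : ℝ) (pt b ν - (((S ν).val * L + c : ℕ) : ZMod N))
        - ∏ ν, tentZ (L : ℝ) (pt (ref j) ν - (((S ν).val * L + c : ℕ) : ZMod N))) ^ 2 ≤ (D * (Real.sqrt 2 / L)) ^ 2 := by
  have hLr : (0 : ℝ) < L := by exact_mod_cast hL
  have hη : (0 : ℝ) ≤ Real.sqrt 2 / L := by positivity
  have hη2 : (Real.sqrt 2 / (L : ℝ)) ^ 2 = 2 / (L : ℝ) ^ 2 := by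
    rw [div_pow, Real.sq_sqrt (by norm_num : (0 : ℝ) ≤ 2)]
  refine hvar_of_chains (K := A → ZMod M)
    (fun (S : A → ZMod M) (ξ : A → ZMod N) => ∏ ν, tentZ (L : ℝ) (ξ ν - (((S ν).val * L + c : ℕ) : ZMod N)))
    pt inc ref hη D fun j b hb => ?_
  obtain ⟨wp, wm, hpt, hD⟩ := hdisp j b hb
  obtain ⟨p, hp0, hpn, hps⟩ := exists_chain (K := A → ZMod M)
    (fun (S : A → ZMod M) (ξ : A → ZMod N) => ∏ ν, tentZ (L : ℝ) (ξ ν - (((S ν).val * L + c : ℕ) : ZMod N)))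
    (β := 2 / (L : ℝ) ^ 2) (fun ζ ν => sum_sq_prod_tentZ_add_one_le L M N hL hM hN c ζ ν)
    (fun ζ ν => sum_sq_prod_tentZ_sub_one_le L M N hL hM hN c ζ ν) wp wm (pt (ref j))
  refine ⟨∑ ν, wp ν + ∑ ν, wm ν, hD, p, hp0, ?_, fun i hi => ?_⟩
  · rw [hpn, hpt]
  · rw [hη2]; exact hps i hi

/-! ## §6 AFLP's term-multiplicity letter `hμ` on the torus -/

/-- **AFLP's `hμ` ON THE TORUS**: for bonds read at sites (`φ_S(c) := Φ_S(pt c)`) and terms with `#inc j ≤ a` bonds,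
`#{S : ∃ c ∈ inc j, φ_S(c) ≠ 0 ∨ φ_S(ref j) ≠ 0} ≤ (a + 1)·2^{#A}` — PPaL `card_alive_on_term_le_of_le` over §2. [folklore] -/
theorem card_alive_on_term_tentZ_le (L M N : ℕ) [NeZero M] [NeZero N] (hL : 0 < L) (hN : N = M * L) (c : ℕ)
    {C J : Type*} (pt : C → A → ZMod N) (inc : J → Finset C) (ref : J → C) {a : ℕ} (ha : ∀ j, (inc j).card ≤ a) (j : J) :
    (Finset.univ.filter fun S : A → ZMod M =>
        ∃ b ∈ inc j, ∏ ν, tentZ (L : ℝ) (pt b ν - (((S ν).val * L + c : ℕ) : ZMod N)) ≠ 0 ∨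
          ∏ ν, tentZ (L : ℝ) (pt (ref j) ν - (((S ν).val * L + c : ℕ) : ZMod N)) ≠ 0).card ≤ (a + 1) * 2 ^ Fintype.card A :=
  card_alive_on_term_le_of_le
    (fun (S : A → ZMod M) (b : C) => ∏ ν, tentZ (L : ℝ) (pt b ν - (((S ν).val * L + c : ℕ) : ZMod N)))
    (fun b => card_alive_prod_tentZ_le L M N hL hN c (pt b)) inc ref ha j


/-- **AFLP's `hμ` SHARPENED FOR UNIT FORWARD DISPLACEMENTS** (plaquette terms): if every bond `b ∈ inc j` is read at the reference site or ONE forward unit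
move from it (`pt b = pt (ref j)` or `pt b = update (pt (ref j)) ν ((pt (ref j)) ν + 1)`), then ALL cubes alive anywhere on the term lie in the one box of
the reference site, so `#{S : ∃ b ∈ inc j, φ_S(b) ≠ 0 ∨ φ_S(ref j) ≠ 0} ≤ 2^{#A}` — `μ = 2^d` instead of `(a+1)·2^d` (§2b; `2 ≤ M`). [folklore] -/
theorem card_alive_on_term_tentZ_le_of_unit (L M N : ℕ) [NeZero M] [NeZero N] (hL : 0 < L) (hM : 2 ≤ M) (hN : N = M * L) (c : ℕ)
    {C J : Type*} (pt : C → A → ZMod N) (inc : J → Finset C) (ref : J → C)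
    (hunit : ∀ j, ∀ b ∈ inc j, pt b = pt (ref j) ∨ ∃ ν, pt b = Function.update (pt (ref j)) ν (pt (ref j) ν + 1)) (j : J) :
    (Finset.univ.filter fun S : A → ZMod M =>
        ∃ b ∈ inc j, ∏ ν, tentZ (L : ℝ) (pt b ν - (((S ν).val * L + c : ℕ) : ZMod N)) ≠ 0 ∨
          ∏ ν, tentZ (L : ℝ) (pt (ref j) ν - (((S ν).val * L + c : ℕ) : ZMod N)) ≠ 0).card ≤ 2 ^ Fintype.card A := by
  classical
  refine (Finset.card_le_card ?_).trans (card_box_le M N L c (pt (ref j)))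
  intro S hS
  rw [Finset.mem_filter] at hS
  obtain ⟨b, hb, h⟩ := hS.2
  rcases h with h | h
  · rcases hunit j b hb with h0 | ⟨ν, hν⟩
    · rw [h0] at h
      exact filter_alive_prod_tentZ_subset_box L M N hL hN c (pt (ref j)) (Finset.mem_filter.mpr ⟨Finset.mem_univ _, h⟩)
    · rw [hν] at h
      exact filter_alive_prod_tentZ_add_one_subset_box L M N hL hM hN c (pt (ref j)) ν (Finset.mem_filter.mpr ⟨Finset.mem_univ _, h⟩)
  · exact filter_alive_prod_tentZ_subset_box L M N hL hN c (pt (ref j)) (Finset.mem_filter.mpr ⟨Finset.mem_univ _, h⟩)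

/-- Unit forward displacements are `ℓ¹`-displacements of length `≤ 1` (`update ξ ν (ξ ν + 1) = ξ + 𝟙_ν − 0`): the `hdisp` letter of §5 with `D = 1`
follows from the `hunit` letter of `card_alive_on_term_tentZ_le_of_unit`. [folklore] -/
theorem hdisp_of_unit {N : ℕ} {C J : Type*} (pt : C → A → ZMod N) (inc : J → Finset C) (ref : J → C)
    (hunit : ∀ j, ∀ b ∈ inc j, pt b = pt (ref j) ∨ ∃ ν, pt b = Function.update (pt (ref j)) ν (pt (ref j) ν + 1)) :
    ∀ j, ∀ b ∈ inc j, ∃ wp wm : A → ℕ,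
      pt b = pt (ref j) + (fun ν => ((wp ν : ℕ) : ZMod N)) - (fun ν => ((wm ν : ℕ) : ZMod N)) ∧ ∑ ν, wp ν + ∑ ν, wm ν ≤ 1 := by
  intro j b hb
  rcases hunit j b hb with h0 | ⟨ν, hν⟩
  · refine ⟨fun _ => 0, fun _ => 0, ?_, by simp⟩
    rw [h0]; funext κ; simp
  · refine ⟨fun κ => if κ = ν then 1 else 0, fun _ => 0, ?_, by simp⟩
    rw [hν]; funext κ
    by_cases h : κ = ν
    · subst h; simp
    · simp [h]

/-! ## §7 Toy: one axis, two cubes of one site -/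

/- `A = Unit`, `M = 2`, `L = 1`, `N = 2`, `c = 0`: the torus partition sums to one at every site. -/
example (ξ : Unit → ZMod 2) :
    ∑ S : Unit → ZMod 2, ∏ ν, tentZ ((1 : ℕ) : ℝ) (ξ ν - (((S ν).val * 1 + 0 : ℕ) : ZMod 2)) = 1 :=
  sum_prod_tentZ_eq_one 1 2 2 one_pos le_rfl rfl 0 ξ

end Summit.QuantumFields.BalabanUV.T4Continuum.NE7b.TentPartitionTorus

end
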